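import Summits.MatrixMultiplication.MatrixMultiplication.Theorems.EdgePencilFlatSummandGauge
import HarnessLib

/-!
# Gauge laws of the flat-summand purchase: the host alone sells at list price, and every
# discounted purchase routes the thin edge's `ζ^{(02)}`-charge through the flat summand

Support kernel for `stmt-MatrixMultiplication-26697` (`TetraExcessZero : ω(K₄) ≤ ω(2,1,2)`, the attacked
leaf of route `TetrahedronCarving`; cut of record `closes (TetraExcessZero) (TetraPlusTwo) : ω = 2`,
UNCHANGED; lineage `decomp-mm-lens-6` «barrier-complement carving», generation 43). No item is added or
changed; no definition is introduced. NOTATION as in `EdgePencilFlatSummandGauge`: `W_n^{(e)} = sixTetra F n e`,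
`D_n = W_n^{(1)}`, `T₄(F) = DTensorClass F 4`, `≲ = AsympLe (· ≤ ·)`, `[t] = DTensorClass.mk t`; the typed
upper-side target of record beneath the leaf is the FLAT-SUMMAND PURCHASE
`RUNG♭(δ) : [W_n^{(⌈n^δ⌉)}] ≲ [D_n] + n⁴` (`EdgePencilFlatSummandPrice.sixRung_of_flatPurchase` is its price
theorem, `…flatPurchase_of_matrixMultiplication` its necessity under `ω = 2`).

THE QUESTION (the cell's writer record for this generation). The purchase is UNDECIDED by the recorded
laws: its kill test is a 4-party spectral point separating `W` from `D ⊕ ⟨n⁴⟩`, its proof a graded-cover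
degeneration mixing the levels of `(D_n ⊕ ⟨n⁴⟩)^{⊠k}`. Which corners of that search space do the HELD
4-party spectral points (the gauge points, `EdgePencilFlatSummandGauge`) close, as theorems? Read a
general purchase `[W_n^{(e)}] ≲ c·[D_n] + m` — `c` host copies and a flat summand `⟨m⟩` — at a point:

* §5 `spectrum_le_of_purchase`: `φ[W] ≤ c·φ[D] + m` for every `φ ∈ X(T₄(F))`. At `ζ^{(0)}`:
  `e n² ≤ c n² + m` (`summand_floor_zero_of_purchase`); at `ζ^{(02)}`: **`e·n³ ≤ c·n³ + m`**
  (`summand_floor_of_purchase`) — BELOW LIST PRICE (`c < e`) THE FLAT SUMMAND CARRIES AT LEAST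
  `(e − c)·n³`, the whole `ζ^{(02)}`-charge of the thin edge above the discount. With no summand:
  **`[W_n^{(e)}] ≲ c·[D_n] ⟹ e ≤ c`** (`le_of_asympLe_mul_diamond`, `e ≤ n`) — THE HOST ALONE SELLS ONLY
  AT LIST PRICE `e` (attained at rank level by the diamond cover
  `tensorRankD_sixTetra_le_mul_diamond : R₄(W_n^{(e)}) ≤ e·R₄(D_n)`); in particular the top level of the
  graded cover alone never certifies a purchase (`not_asympLe_diamond_of_two_le`, `2 ≤ e ≤ n`).
* §6 The purchase of record (`c = 1`, `e = ⌈n^δ⌉`, `δ ≤ 1`): any flat summand `⟨m⟩` that buys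
  `W_n^{(⌈n^δ⌉)}` from ONE diamond has `(⌈n^δ⌉ − 1)·n³ ≤ m` (`summand_floor_of_flatPurchase`): the
  exponent `4` of the summand in `RUNG♭(δ)` cannot be discounted below `3 + δ`; at `δ = 1` the summand
  carries `n⁴ − n³` (`summand_floor_of_flatPurchase_one`; cf. the lineage's D42.1: `RUNG♭(1)` is
  `TetraFlat`-strong). `RUNG♭(δ)` itself passes (`rectDim_sub_one_mul_cube_le_pow_four`): the gauge
  points do not kill it, consistent with the screen of record; a kill needs a point beyond the gauge family.

READING for the cell (memo NODE-g43 of the lineage). Both PURE strategies inside the search space of the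
purchase are now closed by theorems: the host level alone is priced at list (§5); the summand alone is the
absolute purchase and costs `α ≥ 1/2` (`EdgePencilFlatSummandPrice.halfAlpha_of_absolutePurchase`). What
remains is genuine LEVEL MIXING in `(D_n ⊕ ⟨n⁴⟩)^{⊠k}` with a `ζ^{(02)}`-saturated summand.

References: Strassen 1988 (asymptotic spectrum, spectral theorem) [Strassen1988]; Zuiddam 2018, Def. 2.8,
Thm. 2.12 [Zuiddam2018]; Christandl–Vrana–Zuiddam 2023, Thm. 1.1, Example 1.4, Prop. 1.6
[ChristandlVranaZuiddam2023]; Christandl–Vrana–Zuiddam, arXiv:1609.07476, Ex. 1.1.2, §1.2 eq. (flat)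
[ChristandlVranaZuiddam2016].
No `sorry`, no new axiom, no instance, no notation, no definition.
-/

noncomputable section

set_option linter.dupNamespace false

open Finset Literature.Computability.AlgebraicComplexity
open Summit.MatrixMultiplication.MatrixMultiplication.Theorems.TetrahedronTensor
open Summit.MatrixMultiplication.MatrixMultiplication.Theorems.TetraDiagonal
open Summit.MatrixMultiplication.MatrixMultiplication.Theses.TetrahedronCarving

namespace Summit.MatrixMultiplication.MatrixMultiplication.Theorems.EdgePencil

/-! ## §5 The laws: list price for the host alone, gauge floor of the summand -/

section Laws

variable {F : Type*} [Field F]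

/-- **A purchase read at a spectral point**: `[x] ≲ c·[y] + m` gives `φ x ≤ c·φ y + m` for every point
`φ` of the asymptotic spectrum of 4-tensors (spectral theorem, easy direction).
[cite: ChristandlVranaZuiddam2023, Thm. 1.1] -/
theorem spectrum_le_of_purchase {x y : DTensorClass F 4} {c m : ℕ}
    (h : AsympLe (fun x y : DTensorClass F 4 => x ≤ y) x
      ((c : DTensorClass F 4) * y + (m : DTensorClass F 4)))
    {φ : DTensorClass F 4 → ℝ} (hφ : φ ∈ DTensorClass.asymptoticSpectrumDTensors F 2) :
    φ x ≤ c * φ y + m := by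
  have hφ' := DTensorClass.mem_asymptoticSpectrumDTensors_iff.1 hφ
  have := (DTensorClass.asympLe_iff_forall_mem_spectrum.1 h) φ hφ
  rwa [hφ'.map_add, hφ'.map_mul, hφ'.map_natCast, hφ'.map_natCast] at this

/-- **GAUGE FLOOR OF THE SUMMAND** (party-`0` point): a purchase `[W_n^{(e)}] ≲ c·[D_n] + m` of the
thinned tetrahedron from `c` diamonds and a flat summand `⟨m⟩` has `e·n² ≤ c·n² + m`.
[cite: ChristandlVranaZuiddam2023, Example 1.4] -/
theorem summand_floor_zero_of_purchase {n e c m : ℕ} (hn : 1 ≤ n) (he : e ≤ n)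
    (h : AsympLe (fun x y : DTensorClass F 4 => x ≤ y) (DTensorClass.mk (sixTetra F n e))
      ((c : DTensorClass F 4) * DTensorClass.mk (sixTetra F n 1) + (m : DTensorClass F 4))) :
    e * n ^ 2 ≤ c * n ^ 2 + m := by
  have key := spectrum_le_of_purchase h
    (DTensorClass.gaugeRank_mem_asymptoticSpectrumDTensors (K := F) (fun j : Fin 4 => j = 0)
      ⟨0, rfl⟩ ⟨1, by decide⟩)
  have h1 := mul_sq_le_gaugeRank_zero_sixTetra (F := F) hn he
  have h2 := gaugeRank_zero_diamond_le (F := F) hn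
  have : ((e * n ^ 2 : ℕ) : ℝ) ≤ ((c * n ^ 2 + m : ℕ) : ℝ) := by
    calc ((e * n ^ 2 : ℕ) : ℝ)
        ≤ (DTensorClass.gaugeRank (fun j : Fin 4 => j = 0) (DTensorClass.mk (sixTetra F n e)) : ℝ) := by
          exact_mod_cast h1
      _ ≤ c * (DTensorClass.gaugeRank (fun j : Fin 4 => j = 0) (DTensorClass.mk (sixTetra F n 1)) : ℝ)
            + m := key
      _ ≤ c * ((n ^ 2 : ℕ) : ℝ) + m := by
          have h2' : (DTensorClass.gaugeRank (fun j : Fin 4 => j = 0)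
              (DTensorClass.mk (sixTetra F n 1)) : ℝ) ≤ ((n ^ 2 : ℕ) : ℝ) := by exact_mod_cast h2
          nlinarith [mul_le_mul_of_nonneg_left h2' (Nat.cast_nonneg c)]
      _ = ((c * n ^ 2 + m : ℕ) : ℝ) := by push_cast; ring
  exact_mod_cast this

/-- **GAUGE FLOOR OF THE SUMMAND** (pair point `ζ^{(02)}`): a purchase `[W_n^{(e)}] ≲ c·[D_n] + m` has
**`e·n³ ≤ c·n³ + m`** — below list price (`c < e`) the flat summand carries at least `(e − c)·n³`, the
whole `ζ^{(02)}`-charge of the thin edge above the discount. [cite: ChristandlVranaZuiddam2023, Example 1.4] -/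
theorem summand_floor_of_purchase {n e c m : ℕ} (hn : 1 ≤ n) (he : e ≤ n)
    (h : AsympLe (fun x y : DTensorClass F 4 => x ≤ y) (DTensorClass.mk (sixTetra F n e))
      ((c : DTensorClass F 4) * DTensorClass.mk (sixTetra F n 1) + (m : DTensorClass F 4))) :
    e * n ^ 3 ≤ c * n ^ 3 + m := by
  have key := spectrum_le_of_purchase h
    (DTensorClass.gaugeRank_mem_asymptoticSpectrumDTensors (K := F) (fun j : Fin 4 => j = 0 ∨ j = 2)
      ⟨0, Or.inl rfl⟩ ⟨1, by decide⟩)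
  have h1 := mul_cube_le_gaugeRank_pair_sixTetra (F := F) hn he
  have h2 := gaugeRank_pair_diamond_le (F := F) hn
  have : ((e * n ^ 3 : ℕ) : ℝ) ≤ ((c * n ^ 3 + m : ℕ) : ℝ) := by
    calc ((e * n ^ 3 : ℕ) : ℝ)
        ≤ (DTensorClass.gaugeRank (fun j : Fin 4 => j = 0 ∨ j = 2)
            (DTensorClass.mk (sixTetra F n e)) : ℝ) := by exact_mod_cast h1
      _ ≤ c * (DTensorClass.gaugeRank (fun j : Fin 4 => j = 0 ∨ j = 2)
            (DTensorClass.mk (sixTetra F n 1)) : ℝ) + m := key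
      _ ≤ c * ((n ^ 3 : ℕ) : ℝ) + m := by
          have h2' : (DTensorClass.gaugeRank (fun j : Fin 4 => j = 0 ∨ j = 2)
              (DTensorClass.mk (sixTetra F n 1)) : ℝ) ≤ ((n ^ 3 : ℕ) : ℝ) := by exact_mod_cast h2
          nlinarith [mul_le_mul_of_nonneg_left h2' (Nat.cast_nonneg c)]
      _ = ((c * n ^ 3 + m : ℕ) : ℝ) := by push_cast; ring
  exact_mod_cast this

/-- **THE HOST ALONE SELLS AT LIST PRICE**: `[W_n^{(e)}] ≲ c·[D_n]` (no flat summand; `e ≤ n`) forces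
`e ≤ c`. The list price `e` is attained already at rank level (`tensorRankD_sixTetra_le_mul_diamond`).
[cite: ChristandlVranaZuiddam2023, Example 1.4] -/
theorem le_of_asympLe_mul_diamond {n e c : ℕ} (hn : 1 ≤ n) (he : e ≤ n)
    (h : AsympLe (fun x y : DTensorClass F 4 => x ≤ y) (DTensorClass.mk (sixTetra F n e))
      ((c : DTensorClass F 4) * DTensorClass.mk (sixTetra F n 1))) :
    e ≤ c := by
  have h' : AsympLe (fun x y : DTensorClass F 4 => x ≤ y) (DTensorClass.mk (sixTetra F n e))
      ((c : DTensorClass F 4) * DTensorClass.mk (sixTetra F n 1) + ((0 : ℕ) : DTensorClass F 4)) := by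
    simpa using h
  have hf := summand_floor_of_purchase hn he h'
  rw [add_zero] at hf
  exact Nat.le_of_mul_le_mul_right hf (by positivity)

/-- **The top level alone never certifies a purchase**: for `2 ≤ e ≤ n`, `[W_n^{(e)}] ≲ [D_n]` is false.
[cite: ChristandlVranaZuiddam2023, Example 1.4] -/
theorem not_asympLe_diamond_of_two_le {n e : ℕ} (hn : 1 ≤ n) (he : e ≤ n) (h2 : 2 ≤ e) :
    ¬ AsympLe (fun x y : DTensorClass F 4 => x ≤ y) (DTensorClass.mk (sixTetra F n e))
      (DTensorClass.mk (sixTetra F n 1)) := by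
  intro h
  have h' : AsympLe (fun x y : DTensorClass F 4 => x ≤ y) (DTensorClass.mk (sixTetra F n e))
      (((1 : ℕ) : DTensorClass F 4) * DTensorClass.mk (sixTetra F n 1)) := by
    simpa using h
  have := le_of_asympLe_mul_diamond hn he h'
  omega

end Laws

/-! ## §6 The purchase of record: `c = 1`, `e = ⌈n^δ⌉` -/

section Record

variable {F : Type*} [Field F]

/-- **Summand floor of a flat-summand purchase**: if one diamond plus a flat summand `⟨m⟩` buys
`W_n^{(⌈n^δ⌉)}` (`δ ≤ 1`, `n ≥ 1`), then `(⌈n^δ⌉ − 1)·n³ ≤ m` — the exponent of the summand cannot be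
discounted below `3 + δ`. (`RUNG♭(δ)` itself, `m = n⁴`, passes.) [cite: ChristandlVranaZuiddam2023, Example 1.4] -/
theorem summand_floor_of_flatPurchase {δ : ℝ} (hδ : δ ≤ 1) {n m : ℕ} (hn : 1 ≤ n)
    (h : AsympLe (fun x y : DTensorClass F 4 => x ≤ y) (DTensorClass.mk (sixTetra F n (rectDim n δ)))
      (DTensorClass.mk (sixTetra F n 1) + (m : DTensorClass F 4))) :
    (rectDim n δ - 1) * n ^ 3 ≤ m := by
  have he : rectDim n δ ≤ n := by simpa using rectDim_mono hn hδ
  have h' : AsympLe (fun x y : DTensorClass F 4 => x ≤ y) (DTensorClass.mk (sixTetra F n (rectDim n δ)))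
      (((1 : ℕ) : DTensorClass F 4) * DTensorClass.mk (sixTetra F n 1) + (m : DTensorClass F 4)) := by
    simpa using h
  have hf := summand_floor_of_purchase hn he h'
  rw [one_mul] at hf
  rw [Nat.sub_mul, one_mul]
  omega

/-- **At `δ = 1` the summand carries `n⁴ − n³`**: if `[T(K₄)_n] = [W_n^{(n)}] ≲ [D_n] + m` then
`(n − 1)·n³ ≤ m` (cf. the lineage's D42.1: `RUNG♭(1)` is `TetraFlat`-strong).
[cite: ChristandlVranaZuiddam2023, Example 1.4] -/
theorem summand_floor_of_flatPurchase_one {n m : ℕ} (hn : 1 ≤ n)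
    (h : AsympLe (fun x y : DTensorClass F 4 => x ≤ y) (DTensorClass.mk (sixTetra F n n))
      (DTensorClass.mk (sixTetra F n 1) + (m : DTensorClass F 4))) :
    (n - 1) * n ^ 3 ≤ m := by
  have h' : AsympLe (fun x y : DTensorClass F 4 => x ≤ y) (DTensorClass.mk (sixTetra F n n))
      (((1 : ℕ) : DTensorClass F 4) * DTensorClass.mk (sixTetra F n 1) + (m : DTensorClass F 4)) := by
    simpa using h
  have hf := summand_floor_of_purchase hn le_rfl h'
  rw [one_mul] at hf
  rw [Nat.sub_mul, one_mul]
  omega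

/-- **The flat-summand purchase of record passes the pair gauge point** (sanity: the floor
`(⌈n^δ⌉ − 1)·n³ ≤ n⁴` holds for every `δ ≤ 1`; the gauge points do not kill `RUNG♭(δ)`). [folklore] -/
theorem rectDim_sub_one_mul_cube_le_pow_four {δ : ℝ} (hδ : δ ≤ 1) {n : ℕ} (hn : 1 ≤ n) :
    (rectDim n δ - 1) * n ^ 3 ≤ n ^ 4 := by
  have he : rectDim n δ ≤ n := by simpa using rectDim_mono hn hδ
  calc (rectDim n δ - 1) * n ^ 3 ≤ n * n ^ 3 := Nat.mul_le_mul_right _ (by omega)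
    _ = n ^ 4 := by ring

end Record

end Summit.MatrixMultiplication.MatrixMultiplication.Theorems.EdgePencil

end
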